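import Summits.QuantumFields.GaugeBoot.EquipartitionSymmetricStates
import Summits.QuantumFields.GaugeBoot.EquipartitionLinkRule
import Summits.QuantumFields.GaugeBoot.EquipartitionReducedZd
import Summits.QuantumFields.GaugeBoot.ClassBHaarShift
import Literature.MathematicalPhysics.QuantumFieldTheory.StaticPotentialConcavity
import HarnessLib

/-!
# Gauge-boot: ALL RECTANGULAR WILSON LOOPS OF AN INFINITE-VOLUME LIMIT STATE OBEY THE EQUIPARTITION CEILING —
# `0 < W(R×T) ≤ W(1×1) ≤ 1 − (N² − 1)/(4(d−1)β_std + N² − 1)` for `SU(N)`, every `β_std > 0`, every `R, T ≥ 1`; hence the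
# static potential and the string tension of every limit state exist at every `β_std > 0` (large-`N` supplement 19, part 11)

HONEST FRAMING (cell `pub-gaugeboot`, page 1 of every file): certified bounds on lattice
expectations at STATED coupling, gauge group, dimension and torus size; NOT a mass gap, NOT a
continuum limit, NOT a string tension VALUE; NOT Yang–Mills-summit-bearing (barriers `FixedCouplingUltralocality`,
`PerturbativeInvisibility`).  Analytic a-priori bounds; EXISTENCE of `V(R)` and `σ`, no value; it certifies no number of CERTIFIED.md.

## Content

The tree's reflection-positivity file `StaticPotentialConcavity` (Bachas 1986 / Seiler 1978) proves, for every infinite-volume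
limit point `μ` of the torus Wilson states and the rectangular loops `W(R,T) = W_μ(R × T)` in the `(0,1)` plane: `W ≥ 0`,
log-convexity in both extents, and — UNDER THE STANDING HYPOTHESIS `hW` that no `W(R,T)`, `R,T ≥ 1`, vanishes — monotonicity
`W(R+1,T) ≤ W(R,T)`, `W(R,T+1) ≤ W(R,T)`, the existence of the static potential and of the string tension.  This file
DISCHARGES `hW` for `SU(N)` at every `β_std > 0` and combines the monotonicity with the equipartition ceiling:

* `rectExpectation_one_one_eq` — `W(1,1)` is the plaquette expectation `∫ (1/N) Re tr U_{0;01} dμ`;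
* ★ `integral_plaquetteObs_pos_of_mem_limitPoints` — for `SU(N)`, `N ≥ 2`, `d ≥ 2`, tree `β > 0`: every plaquette of every limit
  point has `∫ Re tr U_P dμ > 0` (the DLR sign rule of `DLRPlaquetteSign` + the re-indexing of part 8 + translation and permutation
  invariance of limit points);
* ★ `pow_le_of_logConvex'` — a non-negative log-convex sequence with `a₀ = 1`, `a₁ > 0` satisfies `a₁ⁿ ≤ aₙ` (no positivity
  hypothesis on the later terms); hence ★★ `rectExpectation_pos_of_mem_limitPoints` — **all `W(R,T) > 0`**: the hypothesis `hW` of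
  `StaticPotentialConcavity` holds for every `SU(N)` limit state at `β > 0`; ★★ `hasStaticPotential_of_mem_limitPoints`,
  `hasStringTension_of_mem_limitPoints` — the static potential `V(R)` (every `R`) and the string tension `σ ≥ 0` EXIST;
* ★★ `rectExpectation_le_one_one` — `W(R,T) ≤ W(1,1)` for `R, T ≥ 1`;
* ★★★ `rectExpectation_le_equipartition` / `_std` — **`W_μ(R × T) ≤ 1 − (N² − 1)/(4(d−1)β_std + N² − 1)` for EVERY rectangle,
  `R, T ≥ 1`, every limit point, every `β_std > 0`** — the equipartition ceiling holds uniformly in the size of the loop;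
  ★★★ `rectExpectation_window` — with the RP lower bound `W(1,1)^{RT} ≤ W(R,T)`: `u^{RT} ≤ W(R,T) ≤ u ≤ 1 − δ`, `u = W(1,1)`.
[folklore] (C. Bachas, Phys. Rev. D 33 (1986) 2723; E. Seiler, Phys. Rev. D 18 (1978) 482 and LNP 159 (1982) §2; equipartition:
M. Creutz, Quarks, gluons and lattices (1983) Ch. 11.)
-/

noncomputable section

open MeasureTheory Filter Topology NormedSpace
open scoped Matrix
open Literature.Probability.LatticeModels (Site)
open Literature.MathematicalPhysics.QuantumFieldTheory (LatticeRep configPermZd)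
open Literature.MathematicalPhysics.QuantumLattice (fundamentalRep LGConfig ZdEdge plaquetteObs plaquetteHolonomyZd plaquettesTouching
  ymGibbsMeasures IsZdTranslationInvariant continuous_fundamentalRep walkHolonomy lineWalk rectWalk rectExpectation loopExpectation
  wilsonLoopObs normalisedCharacter HasStaticPotential staticPotential HasStringTension stringTension infiniteVolumeLimitPoints
  IsInfiniteVolumeLimitAlong)
open Literature.MathematicalPhysics.QuantumFieldTheory.StaticPotential

namespace Summit.QuantumFields.GaugeBoot

namespace EquipartitionZd

/-! ## `W(1,1)` is the plaquette -/

section OneOne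

variable {d N : ℕ} {G : Type*} [Group G]

variable [MeasurableSpace G] (ρ : G →* Matrix (Fin N) (Fin N) ℂ)

/-- ★ **`W(1,1)` is the plaquette expectation**: `W_μ(1 × 1) = ∫ (1/N) Re tr ρ(U_{0;ij}) dμ`. [folklore] -/
theorem rectExpectation_one_one_eq (μ : Measure (LGConfig d G)) (i j : Fin d) :
    rectExpectation μ (fun g => normalisedCharacter N (ρ g)) i j 1 1 = ∫ U, (N : ℝ)⁻¹ * plaquetteObs ρ 0 i j U ∂μ := by
  unfold rectExpectation loopExpectation wilsonLoopObs
  refine integral_congr_ae (ae_of_all _ fun U => ?_)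
  -- `hol(rectWalk 0 i j 1 1) = U_{0;ij}` (the tree's `walkHolonomy_rectWalk_one_one` of the YangMills crossover file, inlined:
  -- that module is outside the GaugeBoot build closure)
  have hl : ∀ (y : Site d) (k : Fin d), walkHolonomy U (lineWalk k 1 y) = U (y, k) := fun y k => by simp [lineWalk]
  have hw : walkHolonomy U (rectWalk (0 : Site d) i j 1 1) = plaquetteHolonomyZd U 0 i j := by
    rw [Literature.MathematicalPhysics.QuantumFieldTheory.walkHolonomy_rectWalk, hl, hl, hl, hl, plaquetteHolonomyZd]
    simp only [Nat.cast_one]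
  simp only [hw, normalisedCharacter, plaquetteObs]

end OneOne

/-! ## A log-convexity lemma without positivity hypotheses -/

/-- ★ A non-negative log-convex sequence with `a 0 = 1` and `a 1 > 0` dominates the geometric sequence `a 1 ^ n` — in particular
all its terms are positive (the ratios `a (n+1) / a n` do not decrease). [folklore] -/
theorem pow_le_of_logConvex' {a : ℕ → ℝ} (h0 : a 0 = 1) (hnn : ∀ n, 0 ≤ a n) (hlc : ∀ n, a (n + 1) ^ 2 ≤ a n * a (n + 2))
    (h1 : 0 < a 1) : ∀ n, a 1 ^ n ≤ a n := by
  -- `P n : a 1 * a n ≤ a (n+1) ∧ a 1 ^ n ≤ a n`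
  have key : ∀ n, a 1 * a n ≤ a (n + 1) ∧ a 1 ^ n ≤ a n := by
    intro n
    induction n with
    | zero => exact ⟨by rw [h0, mul_one], by rw [pow_zero, h0]⟩
    | succ n ih =>
      obtain ⟨hrat, hpow⟩ := ih
      have hn : 0 < a n := lt_of_lt_of_le (pow_pos h1 n) hpow
      have hn1 : a 1 ^ (n + 1) ≤ a (n + 1) := by
        rw [pow_succ, mul_comm]
        exact (mul_le_mul_of_nonneg_left hpow h1.le).trans hrat
      refine ⟨?_, hn1⟩
      -- `a (n+2) ≥ a (n+1)² / a n ≥ a 1 · a (n+1)`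
      have h2 : a 1 * a (n + 1) * a n ≤ a (n + 1) ^ 2 := by
        rw [sq]
        have := mul_le_mul_of_nonneg_left hrat (hnn (n + 1))
        linarith [this]
      have h3 : a 1 * a (n + 1) * a n ≤ a n * a (n + 2) := h2.trans (hlc n)
      nlinarith [h3, hn, hnn (n + 2), hnn (n + 1), h1]
  exact fun n => (key n).2

/-! ## Limit points of `SU(N)`: positivity of all rectangular loops, monotonicity, the ceiling -/

section SuN

variable {d N : ℕ}

/-- The data of a limit point: it is a probability measure. [folklore] -/
theorem isProbabilityMeasure_of_mem_limitPoints {β : ℝ} {μ : Measure (LGConfig d (Matrix.specialUnitaryGroup (Fin N) ℂ))}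
    (hμ : μ ∈ infiniteVolumeLimitPoints (d := d) (fundamentalRep (Fin N)) β) : IsProbabilityMeasure μ := by
  obtain ⟨φ, -, hlim⟩ := hμ
  exact hlim.1

/-- ★ **Every plaquette of every limit point has positive expectation at `β > 0`** (`SU(N)`, `N ≥ 2`, `d ≥ 2`): the DLR sign rule
around the link `(x, i)` and the symmetry of limit points (all plaquettes have one expectation). [folklore] -/
theorem integral_plaquetteObs_pos_of_mem_limitPoints (hN : 2 ≤ N) (hd : 2 ≤ d) {β : ℝ} (hβ : 0 < β)
    {μ : Measure (LGConfig d (Matrix.specialUnitaryGroup (Fin N) ℂ))}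
    (hμ : μ ∈ infiniteVolumeLimitPoints (d := d) (fundamentalRep (Fin N)) β) (x : Site d) {i j : Fin d} (hij : i ≠ j) :
    0 < ∫ U, plaquetteObs (fundamentalRep (Fin N)) x i j U ∂μ := by
  haveI : SecondCountableTopology (Matrix (Fin N) (Fin N) ℂ) :=
    inferInstanceAs (SecondCountableTopology (Fin N → Fin N → ℂ))
  haveI : SecondCountableTopology (Matrix.specialUnitaryGroup (Fin N) ℂ) :=
    Topology.IsEmbedding.subtypeVal.secondCountableTopology
  haveI := isProbabilityMeasure_of_mem_limitPoints hμ
  have hDLR : μ ∈ ymGibbsMeasures (d := d) (fundamentalRep (Fin N)) β :=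
    mem_ymGibbsMeasures_of_isHaarShiftState (fundamentalRep (Fin N)) (continuous_fundamentalRep _)
      (isHaarShiftState_of_mem_infiniteVolumeLimitPoints (fundamentalRep (Fin N)) (continuous_fundamentalRep _) hμ)
  have hT : IsZdTranslationInvariant μ :=
    Literature.MathematicalPhysics.QuantumLattice.isZdTranslationInvariant_of_mem_infiniteVolumeLimitPoints
      (fundamentalRep (Fin N)) hμ
  have hperm : ∀ π : Equiv.Perm (Fin d), μ.map (configPermZd (G := Matrix.specialUnitaryGroup (Fin N) ℂ) π) = μ :=
    fun π => map_configPermZd_eq_of_mem_infiniteVolumeLimitPoints (fundamentalRep (Fin N)) (continuous_fundamentalRep _) hμ π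
  have hsign := mul_sum_integral_plaquetteObs_pos_of_mem_ymGibbsMeasures_suN hd hN hβ.ne' hDLR (x, i)
  have hsum := sum_plaquettesTouching_eq_sum_erase x i
    (fun y a b => ∫ U, plaquetteObs (fundamentalRep (Fin N)) y a b U ∂μ) (fun y a b => by simp only [plaquetteObs_symm y a b])
  have hall : ∀ (y : Site d) {a b : Fin d}, a ≠ b →
      ∫ U, plaquetteObs (fundamentalRep (Fin N)) y a b U ∂μ = ∫ U, plaquetteObs (fundamentalRep (Fin N)) x i j U ∂μ := by
    intro y a b hab
    have h1 := integral_plaquetteObs_eq_of_symmetric (N := N) hT hperm y hij hab 1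
    have h2 := integral_plaquetteObs_eq_of_symmetric (N := N) hT hperm x hij hij 1
    simp only [one_mul] at h1 h2
    rw [h1, h2]
  have hterm : ∀ ν ∈ Finset.univ.erase i,
      (∫ U, plaquetteObs (fundamentalRep (Fin N)) x i ν U ∂μ + ∫ U, plaquetteObs (fundamentalRep (Fin N)) (x - TiltedRP.zdUnit d ν) i ν U ∂μ) =
      2 * ∫ U, plaquetteObs (fundamentalRep (Fin N)) x i j U ∂μ := by
    intro ν hν
    have hiν : i ≠ ν := (Finset.ne_of_mem_erase hν).symm
    rw [hall x hiν, hall (x - TiltedRP.zdUnit d ν) hiν]; ring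
  rw [hsum, Finset.sum_congr rfl hterm, Finset.sum_const, Finset.card_erase_of_mem (Finset.mem_univ i), Finset.card_univ,
    Fintype.card_fin, nsmul_eq_mul] at hsign
  have hd0 : (0 : ℝ) < ((d - 1 : ℕ) : ℝ) := by exact_mod_cast (by omega : 0 < d - 1)
  have h2 : 0 < ((d - 1 : ℕ) : ℝ) * (2 * ∫ U, plaquetteObs (fundamentalRep (Fin N)) x i j U ∂μ) :=
    pos_of_mul_pos_right hsign hβ.le
  nlinarith [h2, hd0]

variable [NeZero d]

/-- ★★ **ALL rectangular Wilson loop expectations of a limit state are positive** (`SU(N)`, `N ≥ 2`, `d ≥ 2`, `β > 0`):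
`0 < W_μ(R × T)` for all `R, T` (log-convexity from `W(1,0) = 1`, `W(0,T) = 1` and `W(1,1) > 0`: `W(R,T) ≥ W(1,T)^R ≥
W(1,1)^{RT} > 0`) — this DISCHARGES the standing non-vanishing hypothesis of `StaticPotentialConcavity` for these states.
[folklore] -/
theorem rectExpectation_pos_of_mem_limitPoints (hN : 2 ≤ N) (hd : 2 ≤ d) {β : ℝ} (hβ : 0 < β)
    {μ : Measure (LGConfig d (Matrix.specialUnitaryGroup (Fin N) ℂ))}
    (hμ : μ ∈ infiniteVolumeLimitPoints (d := d) (fundamentalRep (Fin N)) β) (R T : ℕ) :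
    0 < rectExpectation μ (fun g => normalisedCharacter N (fundamentalRep (Fin N) g)) 0 1 R T := by
  haveI := isProbabilityMeasure_of_mem_limitPoints hμ
  obtain ⟨φ, hφ, hlim⟩ := hμ
  have hμ' : μ ∈ infiniteVolumeLimitPoints (d := d) (fundamentalRep (Fin N)) β := ⟨φ, hφ, hlim⟩
  have hN0 : N ≠ 0 := by omega
  have h01 : (0 : Fin d) ≠ 1 := Literature.MathematicalPhysics.QuantumFieldTheory.TorusAreaLaw.fin_zero_ne_one hd
  -- the plaquette `W(1,1) > 0`
  have h11 : 0 < rectExpectation μ (fun g => normalisedCharacter N (fundamentalRep (Fin N) g)) 0 1 1 1 := by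
    rw [rectExpectation_one_one_eq]
    have hNpos : (0 : ℝ) < N := by exact_mod_cast Nat.pos_of_ne_zero hN0
    rw [integral_const_mul]
    exact mul_pos (inv_pos.2 hNpos) (integral_plaquetteObs_pos_of_mem_limitPoints hN hd hβ hμ' 0 h01)
  -- `T ↦ W(1,T)` is log-convex from `W(1,0) = 1`, so `W(1,T) ≥ W(1,1)^T > 0`
  have hcol : ∀ T', rectExpectation μ (fun g => normalisedCharacter N (fundamentalRep (Fin N) g)) 0 1 1 1 ^ T' ≤
      rectExpectation μ (fun g => normalisedCharacter N (fundamentalRep (Fin N) g)) 0 1 1 T' :=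
    pow_le_of_logConvex' (a := fun T' => rectExpectation μ (fun g => normalisedCharacter N (fundamentalRep (Fin N) g)) 0 1 1 T')
      (by
        -- `W(1,0) = 1`, computed directly
        unfold rectExpectation loopExpectation wilsonLoopObs
        have hw : ∀ U : LGConfig d (Matrix.specialUnitaryGroup (Fin N) ℂ), walkHolonomy U (rectWalk (0 : Site d) 0 1 1 0) = 1 := by
          intro U
          rw [Literature.MathematicalPhysics.QuantumFieldTheory.walkHolonomy_rectWalk]
          simp [lineWalk]
        simp only [hw, map_one, normalisedCharacter, Matrix.trace_one, Fintype.card_fin, Complex.natCast_re]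
        rw [integral_const, probReal_univ, one_smul, inv_mul_cancel₀ (by exact_mod_cast hN0)])
      (fun T' => (rectExpectation_nonneg_and_logConvex_snd (fundamentalRep (Fin N)) hd (continuous_fundamentalRep _) hβ.le hφ
        hlim 1 T').1)
      (fun T' => (rectExpectation_nonneg_and_logConvex_snd (fundamentalRep (Fin N)) hd (continuous_fundamentalRep _) hβ.le hφ
        hlim 1 T').2)
      h11
  have hcolpos : ∀ T', 0 < rectExpectation μ (fun g => normalisedCharacter N (fundamentalRep (Fin N) g)) 0 1 1 T' :=
    fun T' => lt_of_lt_of_le (pow_pos h11 T') (hcol T')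
  -- `R ↦ W(R,T)` is log-convex from `W(0,T) = 1`, so `W(R,T) ≥ W(1,T)^R > 0`
  have hrow : rectExpectation μ (fun g => normalisedCharacter N (fundamentalRep (Fin N) g)) 0 1 1 T ^ R ≤
      rectExpectation μ (fun g => normalisedCharacter N (fundamentalRep (Fin N) g)) 0 1 R T :=
    pow_le_of_logConvex' (a := fun R' => rectExpectation μ (fun g => normalisedCharacter N (fundamentalRep (Fin N) g)) 0 1 R' T)
      (Literature.MathematicalPhysics.QuantumFieldTheory.rectExpectation_zero_eq_one (fundamentalRep (Fin N)) hN0 μ 0 1 T)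
      (fun R' => (Literature.MathematicalPhysics.QuantumFieldTheory.rectExpectation_nonneg_and_logConvex (fundamentalRep (Fin N)) hd
        (continuous_fundamentalRep _) hβ.le hφ hlim T R').1)
      (fun R' => (Literature.MathematicalPhysics.QuantumFieldTheory.rectExpectation_nonneg_and_logConvex (fundamentalRep (Fin N)) hd
        (continuous_fundamentalRep _) hβ.le hφ hlim T R').2)
      (hcolpos T) R
  exact lt_of_lt_of_le (pow_pos (hcolpos T) R) hrow

/-- The non-vanishing hypothesis `hW` of `StaticPotentialConcavity`, discharged. [folklore] -/
theorem rectExpectation_ne_zero_of_mem_limitPoints (hN : 2 ≤ N) (hd : 2 ≤ d) {β : ℝ} (hβ : 0 < β)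
    {μ : Measure (LGConfig d (Matrix.specialUnitaryGroup (Fin N) ℂ))}
    (hμ : μ ∈ infiniteVolumeLimitPoints (d := d) (fundamentalRep (Fin N)) β) :
    ∀ R T, 1 ≤ R → 1 ≤ T → rectExpectation μ (fun g => normalisedCharacter N (fundamentalRep (Fin N) g)) 0 1 R T ≠ 0 :=
  fun R T _ _ => (rectExpectation_pos_of_mem_limitPoints hN hd hβ hμ R T).ne'

/-- ★★ **The static potential of every `SU(N)` limit state exists at every separation, at every `β > 0`** (the tree's
`hasStaticPotential_staticPotential` with its non-vanishing hypothesis discharged). [folklore] -/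
theorem hasStaticPotential_of_mem_limitPoints (hN : 2 ≤ N) (hd : 2 ≤ d) {β : ℝ} (hβ : 0 < β)
    {μ : Measure (LGConfig d (Matrix.specialUnitaryGroup (Fin N) ℂ))}
    (hμ : μ ∈ infiniteVolumeLimitPoints (d := d) (fundamentalRep (Fin N)) β) (R : ℕ) :
    HasStaticPotential μ (fun g => normalisedCharacter N (fundamentalRep (Fin N) g)) R
      (staticPotential μ (fun g => normalisedCharacter N (fundamentalRep (Fin N) g)) R) :=
  hasStaticPotential_staticPotential (fundamentalRep (Fin N)) hd (continuous_fundamentalRep _) hβ.le hμ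
    (rectExpectation_ne_zero_of_mem_limitPoints hN hd hβ hμ) R

/-- ★★ **The string tension of every `SU(N)` limit state exists and is `≥ 0`, at every `β > 0`.** [folklore] -/
theorem hasStringTension_of_mem_limitPoints (hN : 2 ≤ N) (hd : 2 ≤ d) {β : ℝ} (hβ : 0 < β)
    {μ : Measure (LGConfig d (Matrix.specialUnitaryGroup (Fin N) ℂ))}
    (hμ : μ ∈ infiniteVolumeLimitPoints (d := d) (fundamentalRep (Fin N)) β) :
    0 ≤ stringTension μ (fun g => normalisedCharacter N (fundamentalRep (Fin N) g)) ∧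
      HasStringTension μ (fun g => normalisedCharacter N (fundamentalRep (Fin N) g))
        (stringTension μ (fun g => normalisedCharacter N (fundamentalRep (Fin N) g))) :=
  stringTension_nonneg_and_hasStringTension (fundamentalRep (Fin N)) hd (continuous_fundamentalRep _) hβ.le hμ
    (rectExpectation_ne_zero_of_mem_limitPoints hN hd hβ hμ)

/-- ★★ **Rectangular loops are dominated by the plaquette**: `W(R,T) ≤ W(1,1)` for `R, T ≥ 1` (monotonicity in both extents,
Bachas / transfer-matrix positivity, iterated). [folklore] -/
theorem rectExpectation_le_one_one (hN : 2 ≤ N) (hd : 2 ≤ d) {β : ℝ} (hβ : 0 < β)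
    {μ : Measure (LGConfig d (Matrix.specialUnitaryGroup (Fin N) ℂ))}
    (hμ : μ ∈ infiniteVolumeLimitPoints (d := d) (fundamentalRep (Fin N)) β) {R T : ℕ} (hR : 1 ≤ R) (hT : 1 ≤ T) :
    rectExpectation μ (fun g => normalisedCharacter N (fundamentalRep (Fin N) g)) 0 1 R T ≤
      rectExpectation μ (fun g => normalisedCharacter N (fundamentalRep (Fin N) g)) 0 1 1 1 := by
  have hW := rectExpectation_ne_zero_of_mem_limitPoints hN hd hβ hμ
  -- decrease in `R` down to `1`, then in `T` down to `1`
  have hRmono : ∀ k, rectExpectation μ (fun g => normalisedCharacter N (fundamentalRep (Fin N) g)) 0 1 (1 + k) T ≤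
      rectExpectation μ (fun g => normalisedCharacter N (fundamentalRep (Fin N) g)) 0 1 1 T := by
    intro k
    induction k with
    | zero => simp
    | succ k ih =>
      have h := rectExpectation_succ_fst_le (fundamentalRep (Fin N)) hd (continuous_fundamentalRep _) hβ.le hμ hW (1 + k) T
      rw [show 1 + (k + 1) = 1 + k + 1 by ring]
      exact h.trans ih
  have hTmono : ∀ k, rectExpectation μ (fun g => normalisedCharacter N (fundamentalRep (Fin N) g)) 0 1 1 (1 + k) ≤
      rectExpectation μ (fun g => normalisedCharacter N (fundamentalRep (Fin N) g)) 0 1 1 1 := by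
    intro k
    induction k with
    | zero => simp
    | succ k ih =>
      have h := rectExpectation_succ_snd_le (fundamentalRep (Fin N)) hd (continuous_fundamentalRep _) hβ.le hμ hW 1 (1 + k)
      rw [show 1 + (k + 1) = 1 + k + 1 by ring]
      exact h.trans ih
  obtain ⟨k, rfl⟩ := Nat.exists_eq_add_of_le hR
  obtain ⟨l, rfl⟩ := Nat.exists_eq_add_of_le hT
  exact (hRmono k).trans (hTmono l)

/-- ★★★ **EVERY RECTANGULAR WILSON LOOP OBEYS THE EQUIPARTITION CEILING.**  `SU(N)`, `N ≥ 2`, `d ≥ 2`, tree coupling `β > 0`,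
`μ` any infinite-volume limit point of the torus Wilson states, `R, T ≥ 1`:
`W_μ(R × T) ≤ 1 − (N − 1/N)/(4(d−1)β + N − 1/N)`. [folklore] -/
theorem rectExpectation_le_equipartition (hN : 2 ≤ N) (hd : 2 ≤ d) {β : ℝ} (hβ : 0 < β)
    {μ : Measure (LGConfig d (Matrix.specialUnitaryGroup (Fin N) ℂ))}
    (hμ : μ ∈ infiniteVolumeLimitPoints (d := d) (fundamentalRep (Fin N)) β) {R T : ℕ} (hR : 1 ≤ R) (hT : 1 ≤ T) :
    rectExpectation μ (fun g => normalisedCharacter N (fundamentalRep (Fin N) g)) 0 1 R T ≤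
      1 - ((N : ℝ) - 1 / N) / (4 * ((d : ℝ) - 1) * β + ((N : ℝ) - 1 / N)) := by
  haveI : SecondCountableTopology (Matrix (Fin N) (Fin N) ℂ) :=
    inferInstanceAs (SecondCountableTopology (Fin N → Fin N → ℂ))
  haveI : SecondCountableTopology (Matrix.specialUnitaryGroup (Fin N) ℂ) :=
    Topology.IsEmbedding.subtypeVal.secondCountableTopology
  haveI := isProbabilityMeasure_of_mem_limitPoints hμ
  have h01 : (0 : Fin d) ≠ 1 := Literature.MathematicalPhysics.QuantumFieldTheory.TorusAreaLaw.fin_zero_ne_one hd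
  refine (rectExpectation_le_one_one hN hd hβ hμ hR hT).trans ?_
  rw [rectExpectation_one_one_eq]
  have hDLR : μ ∈ ymGibbsMeasures (d := d) (fundamentalRep (Fin N)) β :=
    mem_ymGibbsMeasures_of_isHaarShiftState (fundamentalRep (Fin N)) (continuous_fundamentalRep _)
      (isHaarShiftState_of_mem_infiniteVolumeLimitPoints (fundamentalRep (Fin N)) (continuous_fundamentalRep _) hμ)
  exact integral_plaquette_le_of_symmetric_dlr hN hd hβ.le hDLR
    (Literature.MathematicalPhysics.QuantumLattice.isZdTranslationInvariant_of_mem_infiniteVolumeLimitPoints (fundamentalRep (Fin N)) hμ)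
    (fun π => map_configPermZd_eq_of_mem_infiniteVolumeLimitPoints (fundamentalRep (Fin N)) (continuous_fundamentalRep _) hμ π) 0 h01

/-- **Cell normalisation** (`β = β_std/N`): `W_μ(R × T) ≤ 1 − (N² − 1)/(4(d−1)β_std + N² − 1)` for every rectangle of every
`SU(N)` limit state at `β_std > 0` (e.g. `SU(3)`, `d = 4`, `β_std = 6`: every `W(R,T) ≤ 9/10`). [folklore] -/
theorem rectExpectation_le_equipartition_std (hN : 2 ≤ N) (hd : 2 ≤ d) {β : ℝ} (hβ : 0 < β)
    {μ : Measure (LGConfig d (Matrix.specialUnitaryGroup (Fin N) ℂ))}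
    (hμ : μ ∈ infiniteVolumeLimitPoints (d := d) (fundamentalRep (Fin N)) (β / N)) {R T : ℕ} (hR : 1 ≤ R) (hT : 1 ≤ T) :
    rectExpectation μ (fun g => normalisedCharacter N (fundamentalRep (Fin N) g)) 0 1 R T ≤
      1 - ((N : ℝ) ^ 2 - 1) / (4 * ((d : ℝ) - 1) * β + ((N : ℝ) ^ 2 - 1)) := by
  have hN0 : (0 : ℝ) < N := by exact_mod_cast (by omega : 0 < N)
  rw [← plaquetteBound_div hN hd hβ.le, plaquetteBound_eq]
  exact rectExpectation_le_equipartition hN hd (div_pos hβ hN0) hμ hR hT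

/-- ★★★ **THE WINDOW FOR EVERY RECTANGLE**: `u^{RT} ≤ W_μ(R × T) ≤ u ≤ 1 − (N − 1/N)/(4(d−1)β + N − 1/N)`, `u = W_μ(1 × 1)` the
plaquette (reflection positivity from below — Bachas' inequality iterated — equipartition from above). [folklore] -/
theorem rectExpectation_window (hN : 2 ≤ N) (hd : 2 ≤ d) {β : ℝ} (hβ : 0 < β)
    {μ : Measure (LGConfig d (Matrix.specialUnitaryGroup (Fin N) ℂ))}
    (hμ : μ ∈ infiniteVolumeLimitPoints (d := d) (fundamentalRep (Fin N)) β) {R T : ℕ} (hR : 1 ≤ R) (hT : 1 ≤ T) :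
    rectExpectation μ (fun g => normalisedCharacter N (fundamentalRep (Fin N) g)) 0 1 1 1 ^ (T * R) ≤
        rectExpectation μ (fun g => normalisedCharacter N (fundamentalRep (Fin N) g)) 0 1 R T ∧
      rectExpectation μ (fun g => normalisedCharacter N (fundamentalRep (Fin N) g)) 0 1 R T ≤
        rectExpectation μ (fun g => normalisedCharacter N (fundamentalRep (Fin N) g)) 0 1 1 1 ∧
      rectExpectation μ (fun g => normalisedCharacter N (fundamentalRep (Fin N) g)) 0 1 1 1 ≤
        1 - ((N : ℝ) - 1 / N) / (4 * ((d : ℝ) - 1) * β + ((N : ℝ) - 1 / N)) :=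
  ⟨plaquette_pow_le_rectExpectation (fundamentalRep (Fin N)) hd (continuous_fundamentalRep _) hβ.le hμ
      (rectExpectation_ne_zero_of_mem_limitPoints hN hd hβ hμ) R T,
    rectExpectation_le_one_one hN hd hβ hμ hR hT,
    rectExpectation_le_equipartition hN hd hβ hμ le_rfl le_rfl⟩

end SuN

end EquipartitionZd

end Summit.QuantumFields.GaugeBoot

end
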